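import Mathlib.LinearAlgebra.FreeModule.PID
import Mathlib.LinearAlgebra.FreeModule.StrongRankCondition
import Mathlib.LinearAlgebra.Dimension.Free
import Mathlib.Algebra.EuclideanDomain.Int
import Mathlib.RingTheory.PrincipalIdealDomain
import Mathlib.Algebra.Group.Submonoid.Finsupp
import Mathlib.Data.Prod.Lex
import Mathlib.GroupTheory.Finiteness
import Mathlib.Algebra.Order.Group.Basic
import HarnessLib

/-!
# Perron transforms: valuation monoids of lattices are filtered unions of free monoids
(Temkin 2013, Thm. A.2.1 = Knaf–Kuhlmann 2005, Lemma 4.2)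

Topic: `Literature/AlgebraicGeometry/Resolution`. A PROVED leaf below the named fact `Temkin2013`
(`LocalUniformization.lean`; M. Temkin, *Inseparable local uniformization*, J. Algebra 373 (2013)
65–119 = arXiv:0804.1554v3, Thm. 1.3.2), on the branch of Abhyankar valuations
(`Temkin2013Abhyankar`, `InseparableLocalUniformizationAbhyankar.lean` = Thm. 5.5.2 (i)): the
combinatorial core of local uniformization of Abhyankar valuations, **Theorem A.2.1** of the
source (p. 63: "Assume that `Λ°` is a valuation monoid of a "multiplicative" lattice `Λ` and
`(Λ°)ˣ = 1`. Then `Λ°` is a filtered union of its free submonoids with `M^gp ⥲ Λ`. Obviously, it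
is enough just to prove that any finite subset of `Λ°` is contained in a free submonoid.
Surprisingly enough this is not so simple. We refer to [GR, 6.1.30] for an elementary proof"),
which the source uses in §5.3 (p. 55: "`Λ := |K^×|` is a "multiplicative" lattice and
`Λ° := |K° ∖ {0}|` is a valuation monoid in `Λ` … It is well known (see Theorem A.2.1) that `Λ°`
is a filtered union of its free submonoids; in particular, those are cofinal in the family of
toric submonoids of `Λ°`") and in the proof of Thm. 5.5.2 (p. 60: "By Theorem A.2.1, there
exists a free monoid `M'₁ ⊂ Λ°₁` which contains `M₁` … In particular, `x₁` is a smooth point").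

In additive language this is the "positive basis" lemma of Zariski's Perron algorithm, as
isolated by H. Knaf, F.-V. Kuhlmann, *Abhyankar places admit local uniformization in any
characteristic*, Ann. Sci. ENS 38 (2005), **Lemma 4.2** (arXiv:math/0304159, p. 9: "Let `Γ` be
a finitely generated ordered abelian group. Take any non-negative elements `α₁, …, α_ℓ ∈ Γ`.
Then there exist positive elements `γ₁, …, γ_ρ ∈ Γ` such that `Γ = ℤγ₁ ⊕ … ⊕ ℤγ_ρ` and every
`αᵢ` can be written as a sum `∑ⱼ nᵢⱼ γⱼ` with non-negative integers `nᵢⱼ`"; loc. cit.: "it was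
proved (but not explicitly stated) by Zariski in [Z] for subgroups of `ℝ`, using the algorithm
of Perron"). Everything here is PROVED, following the elementary proof of M. de Moraes,
J. Novacoski, *Perron transforms and Hironaka's game*, J. Algebra 563 (2020) 100–110 =
arXiv:1907.02094, §§2–3 (their Thm. 3.3 is Knaf–Kuhlmann's Lemma 4.2).

## Content (everything PROVED)

* §1 `perron_exists_finset_of_le`, `perron_exists_finset` — **de Moraes–Novacoski, Prop. 2.2 /
  Thm. 2.1**: for an integer vector `c : ι → ℤ` with positive mass `P = ∑ (c i)⁺ > 0` and
  negative mass `N = ∑ (c i)⁻ > 0` there is a non-empty index set `J` such that for EVERY pivot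
  `j ∈ J` the move `c j ↦ ∑ k ∈ J, c k` strictly lowers `(min P N, max P N)` lexicographically
  (`J` = the positive entries plus a minimal set of negative entries out-weighing them, or the
  mirror image).
* §2 `exists_basis_perronTransform` — **simple Perron transforms** (loc. cit., Def. 3.1 and
  formula (3.2)) of a basis of a module over any commutative ring: `bᵢ ↦ bᵢ - bⱼ` on `J ∖ {j}`
  is a basis, and coordinates transform by the move of §1.
* §3 `exists_basis_perronTransform_pos` (the transform along a minimal `bⱼ` keeps positivity and
  enlarges the generated monoid), `exists_basis_pos_repr_nonneg_aux` — **Lemma 3.2** (one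
  positive element; well-founded induction on the potential, the ordered group choosing the
  pivot), `exists_basis_pos_forall_repr_nonneg_of_basis` — **Thm. 3.3** from a given positive
  basis, `exists_basis_pos` (a finitely generated ordered abelian group is free with a basis of
  positive elements), and `exists_basis_pos_forall_repr_nonneg` — **Knaf–Kuhlmann 2005,
  Lemma 4.2** as printed.
* §4 `mem_closure_range_basis_iff` (the monoid generated by a `ℤ`-basis = elements with
  non-negative coordinates), `eq_of_sum_nsmul_basis_eq` / `eq_of_prod_pow_basis_eq` (it is free
  on the basis), `addSubgroup_closure_range_basis` / `subgroup_closure_range_basis` (its group of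
  fractions is everything); `exists_basis_pos_subset_closure`,
  `exists_basis_pos_closure_sup_le`, `nonneg_iff_exists_basis_pos_mem_closure` — **Thm. A.2.1 in
  additive ordered form** (finite subsets, directedness, union = non-negative cone);
  `Temkin2013_thmA_2_1`, `Temkin2013_thmA_2_1_directed` — **Thm. A.2.1 as printed**, for a
  submonoid `P = Λ°` of a finitely generated commutative group `Λ` containing `m` or `m⁻¹` for
  every `m` and with `Pˣ = 1`; `exists_basis_lt_one_subset_closure` — the form for ordered
  value groups (`Λ° = {m ≤ 1}`) used in §5.3 and Thm. 5.5.2 of the source;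
  `exists_basis_lt_one_of_injective` — the form for a lattice mapped injectively to an ordered
  group (the exponent lattice `Λ_B` of an Abhyankar basis, ordered by the values `|x^d|`).

## Sources

* M. Temkin, *Inseparable local uniformization*, J. Algebra 373 (2013) 65–119 =
  arXiv:0804.1554v3: §A.1 (toric monoids, p. 62), §A.2 and Thm. A.2.1 (pp. 62–63), §5.3 (p. 55),
  proof of Thm. 5.5.2 (p. 60).
* H. Knaf, F.-V. Kuhlmann, *Abhyankar places admit local uniformization in any characteristic*,
  Ann. Sci. École Norm. Sup. (4) 38 (2005) 833–846 = arXiv:math/0304159: Lemma 4.2 (p. 9 of the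
  arXiv version).
* M. de Moraes, J. Novacoski, *Perron transforms and Hironaka's game*, J. Algebra 563 (2020)
  100–110 = arXiv:1907.02094: Thm. 2.1, Prop. 2.2, Def. 3.1, Lemma 3.2, Thm. 3.3.

## Rendering notes

* "Finitely generated ordered abelian group" ↦ `[AddCommGroup Γ] [LinearOrder Γ]
  [IsOrderedAddMonoid Γ] [Module.Finite ℤ Γ]`; "basis `γ₁, …, γ_ρ` with `Γ = ⊕ ℤγⱼ`" ↦
  `Module.Basis (Fin (Module.finrank ℤ Γ)) ℤ Γ`; "`αᵢ = ∑ nᵢⱼ γⱼ` with `nᵢⱼ ≥ 0`" ↦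
  `∀ j, 0 ≤ b.repr αᵢ j`, equivalently (`mem_closure_range_basis_iff`)
  `αᵢ ∈ AddSubmonoid.closure (Set.range b)` = "`αᵢ ∈ ⟨𝓑⟩₊`".
* Temkin's "multiplicative" lattice `Λ` ↦ `[CommGroup Λ] [Group.FG Λ]`, with `ℤ`-bases taken
  in the `ℤ`-module `Additive Λ`; torsion-freeness ("lattice") is not assumed in
  `Temkin2013_thmA_2_1` since it follows from the valuation-monoid hypotheses; "valuation
  monoid `Λ°` with `(Λ°)ˣ = 1`" ↦ a `Submonoid` `P` with `∀ m, m ∈ P ∨ m⁻¹ ∈ P` and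
  `∀ m ∈ P, m⁻¹ ∈ P → m = 1` (`(Λ°)^gp = Λ` is then automatic); "free submonoid `M` with
  `M^gp ⥲ Λ`" ↦ the submonoid generated by a `ℤ`-basis of `Λ` lying in `P` (free on it by
  `eq_of_prod_pow_basis_eq`, with `M^gp = Λ` by `subgroup_closure_range_basis`; conversely the
  free generators of such an `M` are a `ℤ`-basis of `M^gp = Λ`); "filtered union" ↦ the
  finite-subset statement plus directedness (`Temkin2013_thmA_2_1_directed`).
* The proof is not the one the source cites ([GR, 6.1.30] = Gabber–Ramero): it is Perron's
  algorithm in the form of de Moraes–Novacoski, valid in every height because the pivot of each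
  move is dictated by the order while the potential argument of Prop. 2.2 is insensitive to the
  pivot.
-/

namespace Literature.AlgebraicGeometry.Resolution

open Finset Function

/-! ### §1. The combinatorial engine (de Moraes–Novacoski 2020, Thm. 2.1 / Prop. 2.2)

Coefficient vectors `c : ι → ℤ`; the *move* with support `J` and pivot `j ∈ J` replaces `c j` by
`∑ k ∈ J, c k`; the potential is the pair `(min P N, max P N)` ordered lexicographically, where
`P = ∑ i, (c i).toNat` and `N = ∑ i, (-c i).toNat` are the positive and the negative mass. -/

section Combinatorics

variable {ι : Type*} [Fintype ι] [DecidableEq ι]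

/-- Bookkeeping for a move: the mass of an updated vector. [folklore] -/
theorem perron_sum_update (f : ι → ℕ) (j : ι) (v : ℕ) :
    ∑ i, update f j v i + f j = ∑ i, f i + v := by
  rw [Finset.sum_update_of_mem (Finset.mem_univ j),
    Finset.sum_eq_add_sum_sdiff_singleton_of_mem (Finset.mem_univ j) f]
  ring

omit [DecidableEq ι] in
/-- The positive mass of an integer vector, as an integer, is the sum of its positive entries.
[folklore] -/
theorem perron_cast_sum_toNat (c : ι → ℤ) :
    ((∑ i, (c i).toNat : ℕ) : ℤ) = ∑ i ∈ univ.filter (fun i => 0 < c i), c i := by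
  rw [Nat.cast_sum, Finset.sum_filter]
  refine Finset.sum_congr rfl fun i _ => ?_
  split_ifs with h
  · exact Int.toNat_of_nonneg h.le
  · rw [not_lt] at h
    simp [Int.toNat_eq_zero.mpr h]

/-- Lexicographic decrease of the potential `(min P N, max P N)`, first shape. [folklore] -/
theorem perron_lex_lt_of_le {P N P' N' : ℕ} (hPN : P ≤ N) (h : P' < P ∨ (P' = P ∧ N' < N)) :
    toLex (min P' N', max P' N') < toLex (min P N, max P N) := by
  simp only [Prod.Lex.toLex_lt_toLex, min_def, max_def]
  split_ifs <;> omega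

/-- Lexicographic decrease of the potential `(min P N, max P N)`, second shape. [folklore] -/
theorem perron_lex_lt_of_ge {P N P' N' : ℕ} (hNP : N ≤ P) (h : N' < N ∨ (N' = N ∧ P' < P)) :
    toLex (min P' N', max P' N') < toLex (min P N, max P N) := by
  simp only [Prod.Lex.toLex_lt_toLex, min_def, max_def]
  split_ifs <;> omega

/-- **de Moraes–Novacoski 2020, Prop. 2.2**, for a vector whose positive mass `P` does not exceed
its negative mass `N` (and `P > 0`): there is a non-empty set of indices `J` such that for EVERY
pivot `j ∈ J` the move `c j ↦ ∑ k ∈ J, c k` either lowers `P`, or keeps `P` and lowers `N`.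
(`J` = the indices of the positive entries together with a minimal set of negative entries
out-weighing them.) [cite: DemoraesNovacoski2020, Prop. 2.2] -/
theorem perron_exists_finset_of_le (c : ι → ℤ) (hP : 0 < ∑ i, (c i).toNat)
    (hPN : ∑ i, (c i).toNat ≤ ∑ i, (-c i).toNat) :
    ∃ J : Finset ι, J.Nonempty ∧ ∀ j ∈ J,
      (∑ i, (update c j (∑ k ∈ J, c k) i).toNat < ∑ i, (c i).toNat) ∨
      ((∑ i, (update c j (∑ k ∈ J, c k) i).toNat = ∑ i, (c i).toNat) ∧
        (∑ i, (-update c j (∑ k ∈ J, c k) i).toNat < ∑ i, (-c i).toNat)) := by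
  classical
  -- positive and negative supports, masses as integers
  set R : Finset ι := univ.filter (fun i => 0 < c i) with hR
  set T : Finset ι := univ.filter (fun i => 0 < -c i) with hT
  set P : ℕ := ∑ i, (c i).toNat with hPdef
  set N : ℕ := ∑ i, (-c i).toNat with hNdef
  have hPz : (P : ℤ) = ∑ i ∈ R, c i := perron_cast_sum_toNat c
  have hNz : (N : ℤ) = ∑ i ∈ T, -c i := perron_cast_sum_toNat (fun i => -c i)
  -- a minimal set of negative entries whose mass reaches `P`
  set F : Finset (Finset ι) := T.powerset.filter (fun U => (P : ℤ) ≤ ∑ i ∈ U, -c i) with hF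
  have hTF : T ∈ F := by
    refine Finset.mem_filter.mpr ⟨Finset.mem_powerset.mpr le_rfl, ?_⟩
    rw [← hNz]; exact_mod_cast hPN
  obtain ⟨U, hUF, hUmin⟩ := F.exists_min_image Finset.card ⟨T, hTF⟩
  have hUT : U ⊆ T := Finset.mem_powerset.mp (Finset.mem_filter.mp hUF).1
  have hPU : (P : ℤ) ≤ ∑ i ∈ U, -c i := (Finset.mem_filter.mp hUF).2
  have hUneg : ∀ i ∈ U, c i < 0 := fun i hi => by
    have := (Finset.mem_filter.mp (hUT hi)).2; omega
  -- minimality: removing any element of `U` drops the mass below `P`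
  have hUlt : ∀ t ∈ U, (∑ i ∈ U, -c i) + c t < P := by
    intro t ht
    by_contra hcon
    rw [not_lt] at hcon
    have hmem : U.erase t ∈ F := by
      refine Finset.mem_filter.mpr ⟨Finset.mem_powerset.mpr ((Finset.erase_subset t U).trans hUT), ?_⟩
      rw [Finset.sum_erase_eq_sub ht]
      linarith
    have := hUmin _ hmem
    have := Finset.card_erase_lt_of_mem ht
    omega
  -- the move set
  have hdisj : Disjoint R U := by
    refine Finset.disjoint_left.mpr fun i hiR hiU => ?_
    have h1 := (Finset.mem_filter.mp hiR).2
    have h2 := hUneg i hiU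
    omega
  have hRne : R.Nonempty := by
    by_contra hRe
    rw [Finset.not_nonempty_iff_eq_empty] at hRe
    rw [hRe, Finset.sum_empty] at hPz
    omega
  refine ⟨R ∪ U, hRne.mono Finset.subset_union_left, fun j hj => ?_⟩
  set s : ℤ := ∑ k ∈ R ∪ U, c k with hs
  have hsval : s = P - ∑ i ∈ U, -c i := by
    rw [hs, Finset.sum_union hdisj, hPz, Finset.sum_neg_distrib]; ring
  have hs0 : s ≤ 0 := by rw [hsval]; linarith
  have hstoNat : s.toNat = 0 := Int.toNat_eq_zero.mpr hs0
  -- positive mass after the move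
  have hP' : ∑ i, (update c j s i).toNat + (c j).toNat = P + s.toNat := by
    have : (fun i => (update c j s i).toNat) = update (fun i => (c i).toNat) j s.toNat := by
      funext i
      exact apply_update (fun _ (x : ℤ) => x.toNat) c j s i
    rw [this]
    exact perron_sum_update _ j _
  -- negative mass after the move
  have hN' : ∑ i, (-update c j s i).toNat + (-c j).toNat = N + (-s).toNat := by
    have : (fun i => (-update c j s i).toNat) = update (fun i => (-c i).toNat) j (-s).toNat := by
      funext i
      exact apply_update (fun _ (x : ℤ) => (-x).toNat) c j s i
    rw [this]
    exact perron_sum_update _ j _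
  rw [hstoNat, add_zero] at hP'
  rcases Finset.mem_union.mp hj with hjR | hjU
  · -- pivot at a positive entry: `P` drops by `c j > 0`
    left
    have hcj : 0 < (c j).toNat := by
      have := (Finset.mem_filter.mp hjR).2
      omega
    omega
  · -- pivot at a chosen negative entry: `P` is kept, `N` drops
    right
    have hcj : c j < 0 := hUneg j hjU
    have hcj0 : (c j).toNat = 0 := Int.toNat_eq_zero.mpr hcj.le
    refine ⟨by omega, ?_⟩
    have hlt : (-s).toNat < (-c j).toNat := by
      rw [Int.toNat_lt_toNat (by omega)]
      have := hUlt j hjU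
      rw [hsval]; linarith
    omega

omit [Fintype ι] in
/-- The move commutes with negation. [folklore] -/
theorem perron_update_neg (c : ι → ℤ) (J : Finset ι) (j : ι) :
    update (fun i => -c i) j (∑ k ∈ J, -c k) = fun i => -update c j (∑ k ∈ J, c k) i := by
  funext i
  by_cases h : i = j
  · subst h; simp
  · simp [h]

/-- **de Moraes–Novacoski 2020, Prop. 2.2 / Thm. 2.1** (the engine of Perron's algorithm and
of Hironaka's polyhedra game): if an integer vector `c` has both a positive and a negative entry,
there is a non-empty index set `J` such that for EVERY pivot `j ∈ J` the move
`c j ↦ ∑ k ∈ J, c k` strictly lowers the potential `(min P N, max P N)` (positive mass `P`,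
negative mass `N`) in the lexicographic order. The pivot being arbitrary in `J` is what lets the
ordered group, not the player, choose it below. [cite: DemoraesNovacoski2020, Prop. 2.2] -/
theorem perron_exists_finset (c : ι → ℤ) (hP : 0 < ∑ i, (c i).toNat)
    (hN : 0 < ∑ i, (-c i).toNat) :
    ∃ J : Finset ι, J.Nonempty ∧ ∀ j ∈ J,
      toLex (min (∑ i, (update c j (∑ k ∈ J, c k) i).toNat)
          (∑ i, (-update c j (∑ k ∈ J, c k) i).toNat),
        max (∑ i, (update c j (∑ k ∈ J, c k) i).toNat)
          (∑ i, (-update c j (∑ k ∈ J, c k) i).toNat)) <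
      toLex (min (∑ i, (c i).toNat) (∑ i, (-c i).toNat),
        max (∑ i, (c i).toNat) (∑ i, (-c i).toNat)) := by
  rcases le_total (∑ i, (c i).toNat) (∑ i, (-c i).toNat) with hle | hge
  · obtain ⟨J, hJ, h⟩ := perron_exists_finset_of_le c hP hle
    exact ⟨J, hJ, fun j hj => perron_lex_lt_of_le hle (h j hj)⟩
  · -- apply the first case to `-c`
    have hge' : ∑ i, (-c i).toNat ≤ ∑ i, (-(fun i => -c i) i).toNat := by simpa using hge
    obtain ⟨J, hJ, h⟩ := perron_exists_finset_of_le (fun i => -c i) hN hge'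
    refine ⟨J, hJ, fun j hj => perron_lex_lt_of_ge hge ?_⟩
    have h' := h j hj
    rw [perron_update_neg c J j] at h'
    simpa using h'

end Combinatorics

/-! ### §2. Simple Perron transforms of a basis (de Moraes–Novacoski 2020, Def. 3.1) -/

section Transvection

variable {R : Type*} [CommRing R] {V : Type*} [AddCommGroup V] [Module R V]
variable {ι : Type*} [Fintype ι] [DecidableEq ι]

/-- **Simple Perron transform of a basis** (de Moraes–Novacoski 2020, Definition 3.1 and
formula (3.2)): for a basis `b` of a module over a commutative ring, a finite index set `J` and
a pivot `j ∈ J`, the family `b' i = b i - b j` (`i ∈ J`, `i ≠ j`), `b' i = b i` (otherwise) is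
again a basis, and coordinates transform by the move of §1: the `j`-th coordinate of `x` in `b'`
is `∑ k ∈ J, (b.repr x) k`, the others are unchanged. PROVED (the new basis is built from its
coordinate map, an explicit linear automorphism of `ι → R`).
[cite: DemoraesNovacoski2020, Definition 3.1] -/
theorem exists_basis_perronTransform (b : Module.Basis ι R V) (J : Finset ι) {j : ι}
    (hj : j ∈ J) :
    ∃ b' : Module.Basis ι R V,
      (∀ i, b' i = if i ∈ J ∧ i ≠ j then b i - b j else b i) ∧
      ∀ x i, b'.repr x i = update (⇑(b.repr x)) j (∑ k ∈ J, b.repr x k) i := by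
  classical
  -- the move on coefficient vectors, as a linear automorphism
  let M : (ι → R) ≃ₗ[R] (ι → R) :=
    { toFun := fun d => update d j (∑ k ∈ J, d k)
      map_add' := fun d d' => by
        funext i
        by_cases h : i = j
        · subst h; simp [Finset.sum_add_distrib]
        · simp [h]
      map_smul' := fun r d => by
        funext i
        by_cases h : i = j
        · subst h; simp [Finset.mul_sum]
        · simp [h]
      invFun := fun d => update d j (d j - ∑ k ∈ J.erase j, d k)
      left_inv := fun d => by
        funext i
        by_cases h : i = j
        · subst h
          simp only [update_self]
          rw [Finset.sum_congr rfl (fun k hk => update_of_ne (Finset.ne_of_mem_erase hk) _ d),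
            ← Finset.add_sum_erase J d hj]
          ring
        · simp [h]
      right_inv := fun d => by
        funext i
        by_cases h : i = j
        · subst h
          simp only [update_self]
          rw [← Finset.add_sum_erase J _ hj, update_self,
            Finset.sum_congr rfl (fun k hk => update_of_ne (Finset.ne_of_mem_erase hk) _ d)]
          ring
        · simp [h] }
  have hM : ∀ d i, M d i = update d j (∑ k ∈ J, d k) i := fun d i => rfl
  have hMsymm : ∀ d i, M.symm d i = update d j (d j - ∑ k ∈ J.erase j, d k) i := fun d i => rfl
  let b' : Module.Basis ι R V := Module.Basis.ofEquivFun (b.equivFun.trans M)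
  have hrepr : ∀ x i, b'.repr x i = update (⇑(b.repr x)) j (∑ k ∈ J, b.repr x k) i := by
    intro x i
    rw [Module.Basis.ofEquivFun_repr_apply, LinearEquiv.trans_apply, hM]
    simp only [Module.Basis.equivFun_apply]
  refine ⟨b', fun i => ?_, hrepr⟩
  -- the new basis vectors, computed through their `b`-coordinates
  apply b.equivFun.injective
  have h1 : b.equivFun (b' i) = M.symm (Pi.single i 1) := by
    have : b' i = (b.equivFun.trans M).symm (Pi.single i 1) :=
      congrFun (Module.Basis.coe_ofEquivFun (b.equivFun.trans M)) i
    rw [this, LinearEquiv.symm_trans_apply, LinearEquiv.apply_symm_apply]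
  rw [h1]
  funext k
  rw [hMsymm]
  have hsum : ∑ l ∈ J.erase j, (Pi.single i (1 : R) : ι → R) l = if i ∈ J.erase j then 1 else 0 :=
    Finset.sum_pi_single' i 1 (J.erase j)
  by_cases hcond : i ∈ J ∧ i ≠ j
  · have hiJ : i ∈ J.erase j := Finset.mem_erase.mpr ⟨hcond.2, hcond.1⟩
    rw [if_pos hcond, map_sub, Pi.sub_apply, Module.Basis.equivFun_self,
      Module.Basis.equivFun_self]
    by_cases hk : k = j
    · rw [hk, update_self, hsum, if_pos hiJ, Pi.single_eq_of_ne hcond.2.symm, if_neg hcond.2,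
        if_pos rfl]
    · rw [update_of_ne hk, if_neg (Ne.symm hk), sub_zero]
      by_cases hik : i = k
      · rw [if_pos hik, hik, Pi.single_eq_same]
      · rw [if_neg hik, Pi.single_eq_of_ne (Ne.symm hik)]
  · have hiJ : i ∉ J.erase j := fun h =>
      hcond ⟨(Finset.mem_erase.mp h).2, (Finset.mem_erase.mp h).1⟩
    rw [if_neg hcond, Module.Basis.equivFun_self]
    by_cases hk : k = j
    · rw [hk, update_self, hsum, if_neg hiJ, sub_zero]
      by_cases hij : i = j
      · rw [if_pos hij, hij, Pi.single_eq_same]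
      · rw [if_neg hij, Pi.single_eq_of_ne (Ne.symm hij)]
    · rw [update_of_ne hk]
      by_cases hik : i = k
      · rw [if_pos hik, hik, Pi.single_eq_same]
      · rw [if_neg hik, Pi.single_eq_of_ne (Ne.symm hik)]

end Transvection

/-! ### §3. Ordered groups: Perron's algorithm (de Moraes–Novacoski 2020, Lemma 3.2, Thm. 3.3) -/

section Ordered

variable {Γ : Type*} [AddCommGroup Γ] [LinearOrder Γ] [IsOrderedAddMonoid Γ]
variable {ι : Type*} [Fintype ι] [DecidableEq ι]

omit [DecidableEq ι] in
/-- An element all of whose coordinates in a basis of non-negative vectors are `≤ 0` is `≤ 0`.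
[folklore] -/
theorem nonpos_of_basis_repr_nonpos (b : Module.Basis ι ℤ Γ) (hb : ∀ i, 0 ≤ b i) (x : Γ)
    (hx : ∀ i, b.repr x i ≤ 0) : x ≤ 0 := by
  rw [← b.sum_repr x]
  refine Finset.sum_nonpos fun i _ => ?_
  have h := zsmul_nonneg (hb i) (neg_nonneg.mpr (hx i))
  rw [neg_smul] at h
  exact neg_nonneg.mp h

omit [DecidableEq ι] in
/-- An element all of whose coordinates in a basis of non-negative vectors are `≥ 0` is `≥ 0`:
the monoid generated by such a basis lies in the non-negative cone. [folklore] -/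
theorem nonneg_of_basis_repr_nonneg (b : Module.Basis ι ℤ Γ) (hb : ∀ i, 0 ≤ b i) (x : Γ)
    (hx : ∀ i, 0 ≤ b.repr x i) : 0 ≤ x := by
  rw [← b.sum_repr x]
  exact Finset.sum_nonneg fun i _ => zsmul_nonneg (hb i) (hx i)

/-- **Simple Perron transform** (de Moraes–Novacoski 2020, Definition 3.1: "let
`J ⊆ {1, …, n}` and `j ∈ J` such that `γ_j ≤ γ_i` for all `i ∈ J`. Then `γ⁽¹⁾_i = γ_i - γ_j` if
`i ∈ J ∖ {j}`, `γ_i` otherwise … `𝓑₁` is indeed a basis of `Γ` and is formed by positive elements";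
formula (3.2) for the coordinates; "`⟨𝓑⟩₊ ⊆ ⟨𝓑₁⟩₊`"): subtracting a MINIMAL member `b j`
(`j ∈ J`) from the other members of `J` turns a basis of positive elements of an ordered group
into a basis of positive elements, coordinates transform by the move `c j ↦ ∑ k ∈ J, c k`, and
elements with non-negative coordinates keep non-negative coordinates. PROVED.
[cite: DemoraesNovacoski2020, Definition 3.1] -/
theorem exists_basis_perronTransform_pos (b : Module.Basis ι ℤ Γ) (hb : ∀ i, 0 < b i)
    (J : Finset ι) {j : ι} (hj : j ∈ J) (hmin : ∀ i ∈ J, b j ≤ b i) :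
    ∃ b' : Module.Basis ι ℤ Γ, (∀ i, 0 < b' i) ∧
      (∀ x i, b'.repr x i = update (⇑(b.repr x)) j (∑ k ∈ J, b.repr x k) i) ∧
      ∀ x, (∀ i, 0 ≤ b.repr x i) → ∀ i, 0 ≤ b'.repr x i := by
  obtain ⟨b', hb', hrepr⟩ := exists_basis_perronTransform b J hj
  refine ⟨b', fun i => ?_, hrepr, fun x hx i => ?_⟩
  · rw [hb' i]
    split_ifs with h
    · exact sub_pos.mpr (lt_of_le_of_ne (hmin i h.1) fun heq => h.2 (b.injective heq).symm)
    · exact hb i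
  · rw [hrepr x i, update_apply]
    split_ifs
    · exact Finset.sum_nonneg fun k _ => hx k
    · exact hx i

/-- **Perron's algorithm for one element** (de Moraes–Novacoski 2020, Lemma 3.2: "Let `Γ` be a
finitely generated ordered abelian group, `𝓑` a basis of `Γ` formed by positive elements and
`α ∈ Γ` a positive element. Then there exists a Perron transform `𝓑'` of `𝓑` such that
`α ∈ ⟨𝓑'⟩₊`"), by well-founded induction on the potential of §1 attached to the coordinate vector
of `α`: Prop. 2.2 supplies the index set `J`, the ordered group supplies the pivot (a minimal
`b j`, `j ∈ J`), and positivity of `α` rules out the outcome "all coordinates `≤ 0`". The monoid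
`⟨𝓑⟩₊` only grows along the way. PROVED. [cite: DemoraesNovacoski2020, Lemma 3.2] -/
theorem exists_basis_pos_repr_nonneg_aux (q : ℕ ×ₗ ℕ) :
    ∀ (b : Module.Basis ι ℤ Γ), (∀ i, 0 < b i) → ∀ x : Γ, 0 < x →
      toLex (min (∑ i, (b.repr x i).toNat) (∑ i, (-b.repr x i).toNat),
          max (∑ i, (b.repr x i).toNat) (∑ i, (-b.repr x i).toNat)) = q →
      ∃ b' : Module.Basis ι ℤ Γ, (∀ i, 0 < b' i) ∧
        (∀ y, (∀ i, 0 ≤ b.repr y i) → ∀ i, 0 ≤ b'.repr y i) ∧ ∀ i, 0 ≤ b'.repr x i := by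
  induction q using WellFoundedLT.induction with
  | ind q ih =>
  intro b hb x hx hq
  by_cases hN : ∑ i, (-b.repr x i).toNat = 0
  · refine ⟨b, hb, fun y hy => hy, fun i => ?_⟩
    have h := (Finset.sum_eq_zero_iff.mp hN) i (Finset.mem_univ i)
    rw [Int.toNat_eq_zero, neg_nonpos] at h
    exact h
  by_cases hP : ∑ i, (b.repr x i).toNat = 0
  · exfalso
    refine (nonpos_of_basis_repr_nonpos b (fun i => (hb i).le) x fun i => ?_).not_gt hx
    have h := (Finset.sum_eq_zero_iff.mp hP) i (Finset.mem_univ i)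
    rwa [Int.toNat_eq_zero] at h
  obtain ⟨J, hJne, hJ⟩ :=
    perron_exists_finset (⇑(b.repr x)) (Nat.pos_of_ne_zero hP) (Nat.pos_of_ne_zero hN)
  obtain ⟨j, hjJ, hjmin⟩ := J.exists_min_image (⇑b) hJne
  obtain ⟨b₁, hb₁, hrepr, hmono⟩ := exists_basis_perronTransform_pos b hb J hjJ hjmin
  have hfun : (⇑(b₁.repr x) : ι → ℤ) = update (⇑(b.repr x)) j (∑ k ∈ J, b.repr x k) :=
    funext (hrepr x)
  have hlt := hJ j hjJ
  rw [← hfun, hq] at hlt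
  obtain ⟨b', hb', hmono', hx'⟩ := ih _ hlt b₁ hb₁ x hx rfl
  exact ⟨b', hb', fun y hy => hmono' y (hmono y hy), hx'⟩

/-- **Perron transforms for finitely many elements, from a given positive basis**
(de Moraes–Novacoski 2020, Thm. 3.3, proof: "We start with a basis `𝓑₀` of `Γ` formed by
positive elements. By Lemma 3.2, there is a Perron transform `𝓑₁` of `𝓑₀` such that
`α₁ ∈ ⟨𝓑₁⟩₊` … Since `⟨𝓑₁⟩₊ ⊆ ⟨𝓑₂⟩₊` … Repeating this process"): from any basis `b₀` of
positive elements one reaches a basis `b` of positive elements in which finitely many given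
non-negative elements, and everything that had non-negative `b₀`-coordinates, have non-negative
coordinates. PROVED. [cite: DemoraesNovacoski2020, Thm. 3.3] -/
theorem exists_basis_pos_forall_repr_nonneg_of_basis (b₀ : Module.Basis ι ℤ Γ)
    (hb₀ : ∀ i, 0 < b₀ i) (S : Finset Γ) (hS : ∀ s ∈ S, 0 ≤ s) :
    ∃ b : Module.Basis ι ℤ Γ, (∀ i, 0 < b i) ∧
      (∀ y, (∀ i, 0 ≤ b₀.repr y i) → ∀ i, 0 ≤ b.repr y i) ∧ ∀ s ∈ S, ∀ i, 0 ≤ b.repr s i := by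
  classical
  induction S using Finset.induction_on with
  | empty => exact ⟨b₀, hb₀, fun y hy => hy, by simp⟩
  | insert a S haS ih =>
    obtain ⟨b, hb, hmono, hbS⟩ := ih fun s hs => hS s (Finset.mem_insert_of_mem hs)
    rcases (hS a (Finset.mem_insert_self a S)).eq_or_lt with ha | ha
    · refine ⟨b, hb, hmono, fun s hs i => ?_⟩
      rcases Finset.mem_insert.mp hs with rfl | hs
      · rw [← ha]; simp
      · exact hbS s hs i
    · obtain ⟨b', hb', hmono', ha'⟩ := exists_basis_pos_repr_nonneg_aux _ b hb a ha rfl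
      refine ⟨b', hb', fun y hy => hmono' y (hmono y hy), fun s hs i => ?_⟩
      rcases Finset.mem_insert.mp hs with rfl | hs
      · exact ha' i
      · exact hmono' s (hbS s hs) i

variable (Γ) in
/-- A finitely generated (linearly) ordered abelian group has a `ℤ`-basis of POSITIVE elements
(de Moraes–Novacoski 2020, §3: "Such basis exists because every ordered abelian group is free"):
it is torsion-free, hence free (Mathlib), and one flips the signs of the negative members of any
basis. PROVED. [cite: DemoraesNovacoski2020, Section 3] -/
theorem exists_basis_pos [Module.Finite ℤ Γ] :
    ∃ b : Module.Basis (Fin (Module.finrank ℤ Γ)) ℤ Γ, ∀ i, 0 < b i := by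
  haveI : Module.Free ℤ Γ := Module.free_of_finite_type_torsion_free'
  let b₀ := Module.finBasis ℤ Γ
  refine ⟨b₀.unitsSMul fun i => if b₀ i < 0 then -1 else 1, fun i => ?_⟩
  rw [Module.Basis.unitsSMul_apply]
  split_ifs with h
  · rw [Units.smul_def, Units.val_neg, Units.val_one, neg_smul, one_smul]
    exact neg_pos.mpr h
  · rw [one_smul]
    exact lt_of_le_of_ne (not_lt.mp h) (b₀.ne_zero i).symm

/-- **Knaf–Kuhlmann 2005, Lemma 4.2** ("Let `Γ` be a finitely generated ordered abelian group.
Take any non-negative elements `α₁, …, α_ℓ ∈ Γ`. Then there exist positive elements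
`γ₁, …, γ_ρ ∈ Γ` such that `Γ = ℤγ₁ ⊕ … ⊕ ℤγ_ρ` and every `αᵢ` can be written as a sum
`∑ⱼ nᵢⱼ γⱼ` with non-negative integers `nᵢⱼ`"; attributed there to Zariski [Z] via the
algorithm of Perron, with an "instant proof" in [El, Thm. 2.2]) **= de Moraes–Novacoski 2020,
Thm. 3.3 = Temkin 2013, Thm. A.2.1** in additive ordered form (see `Temkin2013_thmA_2_1` for
the printed monoid form). Here `ρ = rank Γ` and the `γⱼ` are a `Module.Basis`; "non-negative
integer coefficients" is `0 ≤ b.repr αᵢ j`. PROVED (Perron's algorithm as organised in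
de Moraes–Novacoski 2020, §§2–3). [cite: KnafKuhlmann2005, Lemma 4.2] -/
theorem exists_basis_pos_forall_repr_nonneg [Module.Finite ℤ Γ] (S : Finset Γ)
    (hS : ∀ s ∈ S, 0 ≤ s) :
    ∃ b : Module.Basis (Fin (Module.finrank ℤ Γ)) ℤ Γ,
      (∀ i, 0 < b i) ∧ ∀ s ∈ S, ∀ i, 0 ≤ b.repr s i := by
  obtain ⟨b₀, hb₀⟩ := exists_basis_pos Γ
  obtain ⟨b, hb, -, hS'⟩ := exists_basis_pos_forall_repr_nonneg_of_basis b₀ hb₀ S hS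
  exact ⟨b, hb, hS'⟩

end Ordered

/-! ### §4. Free submonoids generated by bases; Temkin's Theorem A.2.1 -/

section FreeSubmonoid

variable {V : Type*} [AddCommGroup V] {ι : Type*} [Fintype ι]

/-- For a `ℤ`-basis `b` of an abelian group, the submonoid generated by `b` ("`⟨𝓑⟩₊`", the
`ℕ`-span) consists exactly of the elements with non-negative `b`-coordinates. [folklore] -/
theorem mem_closure_range_basis_iff (b : Module.Basis ι ℤ V) (x : V) :
    x ∈ AddSubmonoid.closure (Set.range b) ↔ ∀ i, 0 ≤ b.repr x i := by
  constructor
  · intro hx i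
    obtain ⟨a, rfl⟩ := AddSubmonoid.mem_closure_range_iff_of_fintype.mp hx
    have h : (∑ i, a i • b i) = ∑ i, (a i : ℤ) • b i :=
      Finset.sum_congr rfl fun i _ => (natCast_zsmul _ _).symm
    rw [h, b.repr_sum_self]
    exact Int.natCast_nonneg _
  · intro hx
    rw [AddSubmonoid.mem_closure_range_iff_of_fintype]
    refine ⟨fun i => (b.repr x i).toNat, ?_⟩
    conv_lhs => rw [← b.sum_repr x]
    refine Finset.sum_congr rfl fun i _ => ?_
    rw [← natCast_zsmul, Int.toNat_of_nonneg (hx i)]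

/-- The submonoid generated by a `ℤ`-basis is FREE on it: exponent vectors are unique.
[folklore] -/
theorem eq_of_sum_nsmul_basis_eq (b : Module.Basis ι ℤ V) (a a' : ι → ℕ)
    (h : ∑ i, a i • b i = ∑ i, a' i • b i) : a = a' := by
  have h1 : (∑ i, a i • b i) = ∑ i, (a i : ℤ) • b i :=
    Finset.sum_congr rfl fun i _ => (natCast_zsmul _ _).symm
  have h2 : (∑ i, a' i • b i) = ∑ i, (a' i : ℤ) • b i :=
    Finset.sum_congr rfl fun i _ => (natCast_zsmul _ _).symm
  have h3 := b.repr_sum_self fun i => (a i : ℤ)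
  rw [← h1, h, h2, b.repr_sum_self] at h3
  funext i
  exact_mod_cast (congrFun h3 i).symm

omit [Fintype ι] in
/-- … and its group of fractions is the whole group (`M^gp = Λ`): the subgroup generated by a
`ℤ`-basis is everything. [folklore] -/
theorem addSubgroup_closure_range_basis (b : Module.Basis ι ℤ V) :
    AddSubgroup.closure (Set.range b) = ⊤ := by
  rw [← Submodule.span_int_eq_addSubgroupClosure, b.span_eq]
  rfl

end FreeSubmonoid

section OrderedConsequences

variable {Γ : Type*} [AddCommGroup Γ] [LinearOrder Γ] [IsOrderedAddMonoid Γ] [Module.Finite ℤ Γ]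

/-- **Temkin 2013, Thm. A.2.1, additive ordered form, finite-subset version**: in a finitely
generated ordered abelian group every finite set of non-negative elements lies in the submonoid
generated by some basis of positive elements (a free submonoid `M` with `M^gp = Γ`, see
`eq_of_sum_nsmul_basis_eq`, `addSubgroup_closure_range_basis`), and that submonoid lies in the
non-negative cone. PROVED. [cite: Temkin2013, Thm. A.2.1 (p. 63 of arXiv:0804.1554v3)] -/
theorem exists_basis_pos_subset_closure (S : Finset Γ) (hS : ∀ s ∈ S, 0 ≤ s) :
    ∃ b : Module.Basis (Fin (Module.finrank ℤ Γ)) ℤ Γ, (∀ i, 0 < b i) ∧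
      (↑S : Set Γ) ⊆ AddSubmonoid.closure (Set.range b) ∧
      ∀ x ∈ AddSubmonoid.closure (Set.range b), 0 ≤ x := by
  obtain ⟨b, hb, hS'⟩ := exists_basis_pos_forall_repr_nonneg S hS
  refine ⟨b, hb, fun s hs => (mem_closure_range_basis_iff b s).mpr (hS' s hs), fun x hx => ?_⟩
  exact nonneg_of_basis_repr_nonneg b (fun i => (hb i).le) x
    ((mem_closure_range_basis_iff b x).mp hx)

/-- **Temkin 2013, Thm. A.2.1, additive ordered form, "filtered union"**: the non-negative cone
of a finitely generated ordered abelian group is the union of the submonoids generated by its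
bases of positive elements (`exists_basis_pos_subset_closure` with `S = {x}` gives one
direction, positivity of the basis the other), and this family is DIRECTED: the submonoids
generated by any two bases of non-negative elements lie in the submonoid generated by a third
basis, of positive elements. PROVED. [cite: Temkin2013, Thm. A.2.1 (p. 63 of arXiv:0804.1554v3)] -/
theorem exists_basis_pos_closure_sup_le {ι₁ ι₂ : Type*} [Fintype ι₁] [Fintype ι₂]
    (b₁ : Module.Basis ι₁ ℤ Γ) (b₂ : Module.Basis ι₂ ℤ Γ) (h₁ : ∀ i, 0 ≤ b₁ i)
    (h₂ : ∀ i, 0 ≤ b₂ i) :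
    ∃ b : Module.Basis (Fin (Module.finrank ℤ Γ)) ℤ Γ, (∀ i, 0 < b i) ∧
      AddSubmonoid.closure (Set.range b₁) ⊔ AddSubmonoid.closure (Set.range b₂) ≤
        AddSubmonoid.closure (Set.range b) := by
  classical
  obtain ⟨b, hb, hS, -⟩ := exists_basis_pos_subset_closure
    (Finset.univ.image b₁ ∪ Finset.univ.image b₂) (by
      intro s hs
      rcases Finset.mem_union.mp hs with hs | hs
      · obtain ⟨i, -, rfl⟩ := Finset.mem_image.mp hs; exact h₁ i
      · obtain ⟨i, -, rfl⟩ := Finset.mem_image.mp hs; exact h₂ i)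
  refine ⟨b, hb, sup_le (AddSubmonoid.closure_le.mpr ?_) (AddSubmonoid.closure_le.mpr ?_)⟩
  · rintro _ ⟨i, rfl⟩
    exact hS (by simp)
  · rintro _ ⟨i, rfl⟩
    exact hS (by simp)

/-- The union statement itself: `x ≥ 0` iff `x` lies in the submonoid generated by some basis of
positive elements. PROVED. [cite: Temkin2013, Thm. A.2.1 (p. 63 of arXiv:0804.1554v3)] -/
theorem nonneg_iff_exists_basis_pos_mem_closure (x : Γ) :
    0 ≤ x ↔ ∃ b : Module.Basis (Fin (Module.finrank ℤ Γ)) ℤ Γ, (∀ i, 0 < b i) ∧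
      x ∈ AddSubmonoid.closure (Set.range b) := by
  classical
  constructor
  · intro hx
    obtain ⟨b, hb, hS, -⟩ := exists_basis_pos_subset_closure ({x} : Finset Γ) (by simpa using hx)
    exact ⟨b, hb, hS (by simp)⟩
  · rintro ⟨b, hb, hx⟩
    exact nonneg_of_basis_repr_nonneg b (fun i => (hb i).le) x
      ((mem_closure_range_basis_iff b x).mp hx)

end OrderedConsequences

section ValuationMonoid

/-- **Temkin 2013, Theorem A.2.1** (p. 63: "Assume that `Λ°` is a valuation monoid of a
"multiplicative" lattice `Λ` and `(Λ°)ˣ = 1`. Then `Λ°` is a filtered union of its free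
submonoids with `M^gp ⥲ Λ`"; §A.2, p. 62: "a submonoid `Λ°` is a valuation monoid of `Λ` if
`(Λ°)^gp = Λ` and for any element `m ∈ Λ` the monoid `Λ°` contains at least one element from the
set `{m, m⁻¹}`"; p. 63: "Obviously, it is enough just to prove that any finite subset of `Λ°` is
contained in a free submonoid. Surprisingly enough this is not so simple. We refer to
[GR, 6.1.30] for an elementary proof"), in the finite-subset form, for a finitely generated
commutative group `Λ` (written multiplicatively, as the value groups `|K^×|` of §5.3, where
`Λ° = |K° ∖ {0}|`) and a submonoid `P = Λ°` containing `m` or `m⁻¹` for every `m` and with no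
units but `1`: every finite subset of `P` lies in the submonoid generated by a `ℤ`-basis
`b₁, …, b_n` of `Λ` (a basis of the `ℤ`-module `Additive Λ`) consisting of non-trivial elements
of `P`, and that submonoid lies in `P`. Such a submonoid is free on the `bᵢ` with group of
fractions `Λ` (`eq_of_sum_nsmul_basis_eq`, `addSubgroup_closure_range_basis`), and the family of
these submonoids is directed (`exists_basis_pos_closure_sup_le`), so `P` is their filtered union.
Rendering notes: "lattice" = finitely generated and torsion-free; torsion-freeness is not
assumed because it follows from the other hypotheses (`m^k = 1` with `m ∈ P` forces
`m⁻¹ = m^(k-1) ∈ P`, so `m = 1`); `(Λ°)^gp = Λ` is automatic for a submonoid OF `Λ` with the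
valuation property. PROVED, via the order `x ≤ y :⇔ y/x ∈ P` and
`exists_basis_pos_forall_repr_nonneg` (Knaf–Kuhlmann 2005, Lemma 4.2; Perron transforms as in
de Moraes–Novacoski 2020) — an elementary proof different from the one cited in the source.
[cite: Temkin2013, Thm. A.2.1 (p. 63 of arXiv:0804.1554v3)] -/
theorem Temkin2013_thmA_2_1 {Λ : Type*} [CommGroup Λ] [Group.FG Λ] (P : Submonoid Λ)
    (hval : ∀ m : Λ, m ∈ P ∨ m⁻¹ ∈ P) (hunits : ∀ m ∈ P, m⁻¹ ∈ P → m = 1)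
    (S : Finset Λ) (hS : ∀ s ∈ S, s ∈ P) :
    ∃ (n : ℕ) (b : Module.Basis (Fin n) ℤ (Additive Λ)),
      (∀ i, Additive.toMul (b i) ∈ P) ∧ (∀ i, Additive.toMul (b i) ≠ 1) ∧
      (↑S : Set Λ) ⊆ Submonoid.closure (Set.range fun i => Additive.toMul (b i)) ∧
      Submonoid.closure (Set.range fun i => Additive.toMul (b i)) ≤ P := by
  classical
  -- the total order defined by the valuation monoid
  letI : LinearOrder (Additive Λ) :=
    { le := fun x y => Additive.toMul (y - x) ∈ P
      le_refl := fun x => by simp [P.one_mem]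
      le_trans := fun x y z hxy hyz => by
        have := P.mul_mem hxy hyz
        simpa [← toMul_add] using this
      le_antisymm := fun x y hxy hyx => by
        have h1 : Additive.toMul (x - y) = (Additive.toMul (y - x))⁻¹ := by simp
        have := hunits _ hxy (by rw [← h1]; exact hyx)
        have : y - x = 0 := by simpa using congrArg Additive.ofMul this
        exact (sub_eq_zero.mp this).symm
      le_total := fun x y => by
        rcases hval (Additive.toMul (y - x)) with h | h
        · exact Or.inl h
        · right; simpa [← toMul_neg] using h
      toDecidableLE := Classical.decRel _ }
  have hle : ∀ x y : Additive Λ, x ≤ y ↔ Additive.toMul (y - x) ∈ P := fun _ _ => Iff.rfl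
  haveI : IsOrderedAddMonoid (Additive Λ) :=
    { add_le_add_left := fun x y hxy z => by
        rw [hle] at hxy ⊢
        rwa [add_sub_add_right_eq_sub] }
  haveI : Module.Finite ℤ (Additive Λ) := Module.Finite.iff_addGroup_fg.mpr inferInstance
  obtain ⟨b, hb, hbS⟩ := exists_basis_pos_forall_repr_nonneg (Γ := Additive Λ)
    (S.image Additive.ofMul) (by
      intro s hs
      obtain ⟨t, ht, rfl⟩ := Finset.mem_image.mp hs
      rw [hle, sub_zero]
      exact hS t ht)
  have hbP : ∀ i, Additive.toMul (b i) ∈ P := fun i => by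
    have := (hb i).le
    rwa [hle, sub_zero] at this
  refine ⟨_, b, hbP, fun i h1 => ?_, fun s hs => ?_, ?_⟩
  · have h0 : b i = 0 := by simpa using congrArg Additive.ofMul h1
    exact (hb i).ne' h0
  · have hrepr : ∀ i, 0 ≤ b.repr (Additive.ofMul s) i :=
      hbS _ (Finset.mem_image_of_mem _ hs)
    have hsum : ∑ i, (b.repr (Additive.ofMul s) i).toNat • b i = Additive.ofMul s := by
      conv_rhs => rw [← b.sum_repr (Additive.ofMul s)]
      refine Finset.sum_congr rfl fun i _ => ?_
      rw [← natCast_zsmul, Int.toNat_of_nonneg (hrepr i)]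
    have hs' : Additive.toMul (∑ i, (b.repr (Additive.ofMul s) i).toNat • b i) = s := by
      rw [hsum]; rfl
    rw [SetLike.mem_coe, Submonoid.mem_closure_range_iff_of_fintype]
    refine ⟨fun i => (b.repr (Additive.ofMul s) i).toNat, ?_⟩
    conv_lhs => rw [← hs']
    rw [toMul_sum]
    exact Finset.prod_congr rfl fun i _ => toMul_nsmul _ _
  · rw [Submonoid.closure_le]
    rintro _ ⟨i, rfl⟩
    exact hbP i

/-- In the setting of `Temkin2013_thmA_2_1`, the submonoid generated by a `ℤ`-basis of `Λ` is
FREE on it ("free submonoids"): exponent vectors are unique. [folklore] -/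
theorem eq_of_prod_pow_basis_eq {Λ : Type*} [CommGroup Λ] {ι : Type*} [Fintype ι]
    (b : Module.Basis ι ℤ (Additive Λ)) (a a' : ι → ℕ)
    (h : ∏ i, Additive.toMul (b i) ^ a i = ∏ i, Additive.toMul (b i) ^ a' i) : a = a' := by
  refine eq_of_sum_nsmul_basis_eq b a a' ?_
  apply Additive.toMul.injective
  rw [toMul_sum, toMul_sum]
  simpa only [toMul_nsmul] using h

/-- … and its group of fractions is all of `Λ` ("`M^gp ⥲ Λ`"): the subgroup generated by a
`ℤ`-basis of `Additive Λ` is `⊤`. [folklore] -/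
theorem subgroup_closure_range_basis {Λ : Type*} [CommGroup Λ] {ι : Type*} [Fintype ι]
    (b : Module.Basis ι ℤ (Additive Λ)) :
    Subgroup.closure (Set.range fun i => Additive.toMul (b i)) = ⊤ := by
  refine eq_top_iff.mpr fun m _ => ?_
  have hm : Additive.toMul (∑ i, b.repr (Additive.ofMul m) i • b i) = m := by
    rw [b.sum_repr]; rfl
  rw [← hm, toMul_sum]
  refine Subgroup.prod_mem _ fun i _ => ?_
  rw [toMul_zsmul]
  exact Subgroup.zpow_mem _ (Subgroup.subset_closure (Set.mem_range_self i)) _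

/-- **Temkin 2013, Thm. A.2.1, "filtered"**: in the setting of `Temkin2013_thmA_2_1` the free
submonoids generated by bases inside `P = Λ°` form a DIRECTED family — any two of them lie in a
third — so that, together with `Temkin2013_thmA_2_1` (every element of `P` lies in one of them,
and each lies in `P`), `Λ°` is their filtered union. PROVED.
[cite: Temkin2013, Thm. A.2.1 (p. 63 of arXiv:0804.1554v3)] -/
theorem Temkin2013_thmA_2_1_directed {Λ : Type*} [CommGroup Λ] [Group.FG Λ] (P : Submonoid Λ)
    (hval : ∀ m : Λ, m ∈ P ∨ m⁻¹ ∈ P) (hunits : ∀ m ∈ P, m⁻¹ ∈ P → m = 1)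
    {ι₁ ι₂ : Type*} [Fintype ι₁] [Fintype ι₂] (b₁ : Module.Basis ι₁ ℤ (Additive Λ))
    (b₂ : Module.Basis ι₂ ℤ (Additive Λ)) (h₁ : ∀ i, Additive.toMul (b₁ i) ∈ P)
    (h₂ : ∀ i, Additive.toMul (b₂ i) ∈ P) :
    ∃ (n : ℕ) (b : Module.Basis (Fin n) ℤ (Additive Λ)),
      (∀ i, Additive.toMul (b i) ∈ P) ∧ (∀ i, Additive.toMul (b i) ≠ 1) ∧
      Submonoid.closure (Set.range fun i => Additive.toMul (b₁ i)) ⊔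
          Submonoid.closure (Set.range fun i => Additive.toMul (b₂ i)) ≤
        Submonoid.closure (Set.range fun i => Additive.toMul (b i)) ∧
      Submonoid.closure (Set.range fun i => Additive.toMul (b i)) ≤ P := by
  classical
  obtain ⟨n, b, hbP, hb1, hS, hle⟩ := Temkin2013_thmA_2_1 P hval hunits
    (Finset.univ.image (fun i => Additive.toMul (b₁ i)) ∪
      Finset.univ.image (fun i => Additive.toMul (b₂ i))) (by
      intro s hs
      rcases Finset.mem_union.mp hs with hs | hs
      · obtain ⟨i, -, rfl⟩ := Finset.mem_image.mp hs; exact h₁ i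
      · obtain ⟨i, -, rfl⟩ := Finset.mem_image.mp hs; exact h₂ i)
  refine ⟨n, b, hbP, hb1, sup_le (Submonoid.closure_le.mpr ?_) (Submonoid.closure_le.mpr ?_), hle⟩
  · rintro _ ⟨i, rfl⟩
    exact hS (by simp)
  · rintro _ ⟨i, rfl⟩
    exact hS (by simp)

/-- **Temkin 2013, Thm. A.2.1 for ordered value groups** (the form used in §5.3, p. 55:
"`Λ := |K^×|` is a "multiplicative" lattice and `Λ° := |K° ∖ {0}|` is a valuation monoid in `Λ`
… It is well known (see Theorem A.2.1) that `Λ°` is a filtered union of its free submonoids; in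
particular, those are cofinal in the family of toric submonoids of `Λ°`", and in the proof of
Thm. 5.5.2, p. 60: "By Theorem A.2.1, there exists a free monoid `M'₁ ⊂ Λ°₁` which contains
`M₁`"): in a finitely generated (linearly) ordered commutative group, written multiplicatively
with `Λ° = {m ≤ 1}`, every finite set of elements `≤ 1` lies in the submonoid generated by a
`ℤ`-basis of elements `< 1`, all of whose elements are `≤ 1`. PROVED (`Temkin2013_thmA_2_1` with
`P = {m ≤ 1}`). [cite: Temkin2013, Thm. A.2.1 (p. 63 of arXiv:0804.1554v3)] -/
theorem exists_basis_lt_one_subset_closure {Λ : Type*} [CommGroup Λ] [LinearOrder Λ]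
    [IsOrderedMonoid Λ] [Group.FG Λ] (S : Finset Λ) (hS : ∀ s ∈ S, s ≤ 1) :
    ∃ (n : ℕ) (b : Module.Basis (Fin n) ℤ (Additive Λ)),
      (∀ i, Additive.toMul (b i) < 1) ∧
      (↑S : Set Λ) ⊆ Submonoid.closure (Set.range fun i => Additive.toMul (b i)) ∧
      ∀ m ∈ Submonoid.closure (Set.range fun i => Additive.toMul (b i)), m ≤ 1 := by
  let P : Submonoid Λ :=
    { carrier := {m | m ≤ 1}
      one_mem' := le_rfl
      mul_mem' := fun ha hb => mul_le_one' ha hb }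
  have hmem : ∀ m, m ∈ P ↔ m ≤ 1 := fun _ => Iff.rfl
  obtain ⟨n, b, hbP, hb1, hS', hle⟩ := Temkin2013_thmA_2_1 P
    (fun m => (le_total m 1).imp id fun h => (hmem _).mpr (inv_le_one'.mpr h))
    (fun m hm hm' => le_antisymm hm (inv_le_one'.mp hm')) S hS
  exact ⟨n, b, fun i => lt_of_le_of_ne (hbP i) (hb1 i), hS', fun m hm => hle hm⟩

/-- **Thm. A.2.1 for a lattice valued in an ordered group** (the shape of §5.3 of the source:
the lattice of exponent vectors `Λ_B ≅ ℤ^E` of an Abhyankar basis, ordered through the values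
`|x^d|` of its monomials, which are pairwise distinct): for a finitely generated abelian group `V`,
an INJECTIVE homomorphism `φ` from `V` to a (linearly) ordered commutative group `Γ` (written
multiplicatively, as a value group) and finitely many `d ∈ V` of value `φ d ≤ 1`, there is a
`ℤ`-basis `e` of `V` all of whose members have value `< 1` such that each `d` is a combination of
the `eᵢ` with coefficients in `ℕ`. PROVED (`exists_basis_pos_forall_repr_nonneg` for the order
on `V` pulled back from `Γ`). [cite: Temkin2013, Thm. A.2.1 (p. 63 of arXiv:0804.1554v3)] -/
theorem exists_basis_lt_one_of_injective {V : Type*} [AddCommGroup V] [AddGroup.FG V]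
    {Γ : Type*} [CommGroup Γ] [LinearOrder Γ] [IsOrderedMonoid Γ]
    (φ : V →+ Additive Γ) (hφ : Function.Injective φ) (D : Finset V)
    (hD : ∀ d ∈ D, Additive.toMul (φ d) ≤ 1) :
    ∃ e : Module.Basis (Fin (Module.finrank ℤ V)) ℤ V,
      (∀ i, Additive.toMul (φ (e i)) < 1) ∧ (∀ d ∈ D, ∀ i, 0 ≤ e.repr d i) ∧
      ∀ d ∈ D, ∃ c : Fin (Module.finrank ℤ V) → ℕ, d = ∑ i, c i • e i := by
  -- the order on `V` pulled back from the dual of `Γ`: `v ≤ w ↔ φ w ≤ φ v`, so that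
  -- `0 ≤ v ↔ φ v ≤ 1`
  let f : V → Γᵒᵈ := fun v => OrderDual.toDual (Additive.toMul (φ v))
  have hf : Function.Injective f := fun v w h => hφ (Additive.toMul.injective (by
    simpa [f] using h))
  letI : LinearOrder V := LinearOrder.lift' f hf
  have hle : ∀ v w : V, v ≤ w ↔ Additive.toMul (φ w) ≤ Additive.toMul (φ v) := fun v w => Iff.rfl
  have hlt : ∀ v w : V, v < w ↔ Additive.toMul (φ w) < Additive.toMul (φ v) := fun v w => by
    rw [lt_iff_le_not_ge, hle, hle, lt_iff_le_not_ge]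
  haveI : IsOrderedAddMonoid V :=
    { add_le_add_left := fun v w hvw u => by
        rw [hle] at hvw ⊢
        simpa [map_add, toMul_add, mul_comm] using mul_le_mul_left hvw (Additive.toMul (φ u)) }
  haveI : Module.Finite ℤ V := Module.Finite.iff_addGroup_fg.mpr inferInstance
  obtain ⟨e, he, hD'⟩ := exists_basis_pos_forall_repr_nonneg (Γ := V) D fun d hd => by
    rw [hle, map_zero, toMul_zero]
    exact hD d hd
  refine ⟨e, fun i => ?_, hD', fun d hd => ⟨fun i => (e.repr d i).toNat, ?_⟩⟩
  · have := he i
    rw [hlt, map_zero, toMul_zero] at this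
    exact this
  · conv_lhs => rw [← e.sum_repr d]
    refine Finset.sum_congr rfl fun i _ => ?_
    rw [← natCast_zsmul, Int.toNat_of_nonneg (hD' d hd i)]

end ValuationMonoid

end Literature.AlgebraicGeometry.Resolution
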